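import Summits.CriticalPhenomena.SAWScalingLimit.Theorems.SAWRenewalTightnessSubseqIdentificationSleRestrictionTransport
import HarnessLib

/-!
# The SLE-side restriction identity in product form on the half-plane (line `boundary-area-law`, RS5a)

Line `boundary-area-law` of the crux `SubseqIdentification` (stmt-CriticalPhenomena-0783, route
`SAWRenewalTightness`; primary decl `SAWParafermion.SubseqIdentification`), restriction reshape
(lead c4, r-c4-3): the stub RS5 (SLE restriction rigidity below `8/3`) is split into RS5a (this
file), RS5b (the tilted [LSW] Thm. 6.5) and RS5c (non-degeneracy of the compensator). RS5a is
pure bookkeeping, valid for EVERY `0 < κ ≤ 4`: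

* `stub_sleAvoidProductOfIdentity` — if the restriction identity
  `μ'(T) · μ(N_r) = μ(T ∩ N_r)` (`N_r = {c | r ≤ dist(x₀, trace c)}`) holds for all Borel `T`
  between the chordal SLE_κ laws `μ` of a flat-window Dobrushin domain `(D; a, b)` and `μ'` of
  the carved domain `D' = D ∖ B̄(x₀, r)` (same marked points), then there are a nonempty hull
  `A ∈ 𝒬*` and its restriction map `Φ = Φ_A` such that the SLE_κ trace `γ` on the canonical
  space satisfies, for every `B ∈ 𝒬*`,
  `P[γ ∩ A = ∅, Φ(γ(0, ∞)) ∩ B = ∅] = P[γ ∩ A = ∅] · P[γ ∩ B = ∅]`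
  — conditionally on avoiding `A`, the curve `Φ_A(γ)` avoids hulls with the SLE_κ
  probabilities.

**Proof.** Write `μ = P ∘ Γ⁻¹` through a chordal uniformizing map `φ` of `D` (the `IsSLELaw`
witness), let `A = cl(ℍ ∖ φ⁻¹ D')` be the pulled-back hull (`IsStarHull.pullbackHull`; it
contains `φ⁻¹(x₀ + i r/2)`, hence is nonempty), `Φ = Φ_A`
(`IsStarHull.existsUnique_isRestrictionMap_holds`) and `ψ = φ ∘ Φ⁻¹`, a chordal uniformizing
map of `D'` (`IsChordalUniformizing.pullback`). By uniqueness in law of chordal SLE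
(`IsSLECurve.map_eq_holds`) and the construction of the SLE curve through a prescribed
uniformizing map (`exists_isSLECurve_through_of_ae_tendsto`; transience at `κ` comes from the
`IsSLELaw` witness, `IsSLECurve.ae_tendsto_norm_sleTrace_atTop`), `μ' = P ∘ Γ'⁻¹` with `Γ'` the
class of the compactified image of `γ` under `ψ`. The first half, landed as
`sleRestriction_canonical_of_identity`, gives `μ'(T) · P[γ ∩ A = ∅] = P({γ ∩ A = ∅} ∩ Γ⁻¹ T)`
for Borel `T`; evaluate it at the avoidance event `T_B = {c | c ∩ ψ̄(B) = ∅}` of the image test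
set `ψ.boundaryExtension '' B`: a.s. (the trace is simple and in `ℍ` for positive times,
Rohde–Schramm Thm. 6.1) `Γ' ∈ T_B ↔ γ ∩ B = ∅`
(`IsCompactifiedImage.mk_mem_rangeSubset_compl_image_iff`) and, on `{γ ∩ A = ∅}`,
`Γ ∈ T_B ↔ ∀ t > 0, Φ(γ t) ∉ B` (`mk_mem_rangeSubset_compl_image_iff_of_disjoint`). This is the
second half of `IsSLELaw.hullRestriction_eightThirds_of_sle_restriction` (`SLERestrictionLocal`)
run backwards, where no measure extension is needed.

References: G. F. Lawler, O. Schramm, W. Werner, *Conformal restriction: the chordal case*,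
J. Amer. Math. Soc. 16 (2003), §2 p. 9 (covariance under `𝒜₁`) and Prop. 3.3 (1); S. Rohde,
O. Schramm, *Basic properties of SLE*, Ann. of Math. 161 (2005), Thm. 6.1. No named fact is used.
-/

noncomputable section

open MeasureTheory Filter Topology Set Metric
open scoped NNReal ENNReal
open Literature.Probability.RandomPlanarGeometry
open Literature.Probability.Process (preWienerMeasure)
open UpperHalfPlane (upperHalfPlaneSet)

namespace Summit.CriticalPhenomena.SAWScalingLimit.Theorems.SubseqIdentification.BoundaryAreaLaw

/-- **The pulled-back hull of the carved domain is nonempty**: with the flat window at `x₀`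
(`0 < r < ρ₀`), the point `x₀ + i r/2` lies in `D ∖ D'`, so its preimage under the uniformizing
map `φ` lies in `ℍ ∖ φ⁻¹ D' ⊆ A`. [folklore] -/
theorem pullbackHull_carved_nonempty {D D' : DobrushinDomain}
    (φ : ConformalEquiv upperHalfPlaneSet D.carrier) {x₀ : ℂ} {ρ₀ r : ℝ} (hr : 0 < r)
    (hrρ : r < ρ₀) (hwin : D.carrier ∩ ball x₀ ρ₀ = {z : ℂ | x₀.im < z.im} ∩ ball x₀ ρ₀)
    (hD' : D'.carrier = D.carrier \ closedBall x₀ r) : (φ.pullbackHull D').Nonempty := by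
  set z : ℂ := x₀ + ((r / 2 : ℝ) : ℂ) * Complex.I with hz
  have hdist : dist z x₀ = r / 2 := by
    rw [dist_eq_norm, hz, add_sub_cancel_left, norm_mul, Complex.norm_real, Complex.norm_I,
      mul_one, Real.norm_eq_abs, abs_of_pos (by positivity)]
  have him : x₀.im < z.im := by
    have h2 : z.im = x₀.im + r / 2 := by simp [hz]
    rw [h2]
    linarith
  have hzD : z ∈ D.carrier := by
    have hmem : z ∈ {z : ℂ | x₀.im < z.im} ∩ ball x₀ ρ₀ :=
      ⟨him, by rw [mem_ball, hdist]; linarith⟩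
    rw [← hwin] at hmem
    exact hmem.1
  have hzD' : z ∉ D'.carrier := by
    rw [hD']
    exact fun h ↦ h.2 (by rw [mem_closedBall, hdist]; linarith)
  refine ⟨φ.symm z, subset_closure ⟨φ.symm_mapsTo hzD, fun h ↦ hzD' ?_⟩⟩
  have h2 := h.2
  rwa [φ.apply_symm_apply hzD] at h2

/-- **RS5a — HULL FORM OF THE RESTRICTION IDENTITY (product formula on the half-plane).** For
`0 < κ ≤ 4`, let `(D; a, b)` have a flat horizontal window at `x₀` of radius `ρ₀` missing the
marked points, `D' = D ∖ B̄(x₀, r)` (`0 < r < ρ₀`, same marked points), `μ`, `μ'` chordal SLE_κ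
laws of `D`, `D'`, and suppose `μ'(T) · μ(N_r) = μ(T ∩ N_r)` for all Borel `T`
(`N_r = {c | r ≤ dist(x₀, trace c)}`). Then there are `A ∈ 𝒬*` nonempty (the pull-back of the
carved half-ball along the uniformizing map of the `IsSLELaw κ D μ` witness) and a restriction
map `Φ = Φ_A` with
`P[γ ∩ A = ∅, ∀ t > 0, Φ(γ t) ∉ B] = P[γ ∩ A = ∅] · P[γ ∩ B = ∅]` for every `B ∈ 𝒬*`
(`γ = sleTrace κ`, `P = preWienerMeasure`): conditionally on `{γ ∩ A = ∅}` the curve `Φ_A(γ)`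
is an SLE_κ, tested on hull avoidance. First half: `sleRestriction_canonical_of_identity`;
second half: uniqueness in law through `ψ = φ ∘ Φ_A⁻¹` and the event dictionary of
`HullRestrictionSLE`. [cite: LawlerSchrammWerner2003Restriction, §2 p. 9; Prop. 3.3 (1)] -/
theorem stub_sleAvoidProductOfIdentity :
    ∀ (κ : ℝ≥0), 0 < κ → κ ≤ 4 →
      ∀ (D D' : DobrushinDomain) (μ μ' : Measure (CurveClass ℂ)) (x₀ : ℂ) (ρ₀ r : ℝ),
        0 < r → r < ρ₀ →
        D.carrier ∩ Metric.ball x₀ ρ₀ = {z : ℂ | x₀.im < z.im} ∩ Metric.ball x₀ ρ₀ →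
        ρ₀ ≤ dist x₀ (D.pt 0) → ρ₀ ≤ dist x₀ (D.pt 1) →
        D'.carrier = D.carrier \ Metric.closedBall x₀ r → D'.pt 0 = D.pt 0 → D'.pt 1 = D.pt 1 →
        IsSLELaw κ D μ → IsSLELaw κ D' μ' →
        (∀ T : Set (CurveClass ℂ), MeasurableSet T →
            μ' T * μ {c | r ≤ Metric.infDist x₀ c.range} = μ (T ∩ {c | r ≤ Metric.infDist x₀ c.range})) →
        ∃ (A : Set ℂ) (Φ : ConformalEquiv (upperHalfPlaneSet \ A) upperHalfPlaneSet),
          IsStarHull A ∧ A.Nonempty ∧ IsRestrictionMap A Φ ∧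
            ∀ (B : Set ℂ), IsStarHull B →
              preWienerMeasure {ω | Disjoint (range (sleTrace κ ω)) A ∧ ∀ t, 0 < t → Φ (sleTrace κ ω t) ∉ B} =
                preWienerMeasure {ω | Disjoint (range (sleTrace κ ω)) A} *
                  preWienerMeasure {ω | Disjoint (range (sleTrace κ ω)) B} := by
  intro κ hκ0 hκ4 D D' μ μ' x₀ ρ₀ r hr hrρ hwin ha hb hD' h0 h1 hμ hμ' hid
  -- classical inputs, all theorems of the tree
  have hexΦ : IsStarHull.existsUnique_isRestrictionMap :=
    IsStarHull.existsUnique_isRestrictionMap_holds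
  have hsc : ∀ D : JordanDomain, D.isSimplyConnected := JordanDomain.isSimplyConnected_holds
  have hRM : ∀ {U : Set ℂ}, exists_conformalEquiv_ball (U := U) := exists_conformalEquiv_ball_holds
  have hC : JordanDomain.exists_continuousOn_extension :=
    JordanDomain.exists_continuousOn_extension_holds
  have hext : JordanDomain.continuousOn_boundaryExtension :=
    JordanDomain.continuousOn_boundaryExtension_holds
  have hmeas : aemeasurable_sleTrace := aemeasurable_sleTrace_holds
  have hsub : D.IsHullSubdomain D' := isHullSubdomain_of_carved hrρ ha hb hD' h0 h1
  -- trace facts at `κ`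
  have hgen : HasSLETrace κ := hμ.hasSLETrace
  have h₆ : ae_isSimpleTrace_sleTrace_of_le_four (κ := κ) :=
    fun _ h4 ↦ ae_isSimpleTrace_sleTrace_of_hasSLETrace hgen h4
  -- the first half (canonical-space form of the identity)
  have hcan := sleRestriction_canonical_of_identity κ hκ0 hκ4 D D' μ μ' x₀ ρ₀ r hr hrρ hwin ha hb
    hD' h0 h1 hμ hμ' hid
  -- the SLE curve of `D`, its uniformizing map `φ`, the pulled-back hull and `Φ = Φ_A`
  obtain ⟨Γ, hΓ, rfl⟩ := hμ
  have htr := hΓ.ae_tendsto_norm_sleTrace_atTop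
  obtain ⟨hΓm, φ, hφ, hΓae⟩ := hΓ
  have hA : IsStarHull (φ.pullbackHull D') := IsStarHull.pullbackHull hsc hφ hsub
  obtain ⟨Φ, hΦ, -⟩ := hexΦ hA
  have hdesc : ∀ᵐ ω ∂preWienerMeasure, ∃ c : Curve ℂ, Γ ω = CurveClass.mk c ∧
      IsCompactifiedImage φ.boundaryExtension (sleTrace κ ω) (D.pt 1) c :=
    hΓae.mono fun ω hω ↦ hω.2
  obtain ⟨-, hcanT⟩ := hcan Γ φ hφ hΓm hdesc rfl
  -- the uniformizing map `ψ = φ ∘ Φ⁻¹` of `D'` and the SLE law of `D'` through it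
  set ψ : ConformalEquiv upperHalfPlaneSet D'.carrier :=
    Φ.symm.trans (φ.restrHull D' hsub.carrier_subset) with hψdef
  have hψ : D'.IsChordalUniformizing ψ :=
    MarkedDomain.IsChordalUniformizing.pullback hsc hRM hC hφ hsub hΦ
  have hψsymm : ∀ w, ψ.symm w = Φ (φ.symm w) := fun w ↦ rfl
  obtain ⟨Γ', rfl, hΓ'm, hΓ'ae⟩ : ∃ Γ' : (ℝ≥0 → ℝ) → CurveClass ℂ,
      μ' = preWienerMeasure.map Γ' ∧ AEMeasurable Γ' preWienerMeasure ∧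
      ∀ᵐ ω ∂preWienerMeasure, Loewner.IsGeneratedByCurve (sleDriving κ ω) (sleTrace κ ω) ∧
        ∃ c : Curve ℂ, Γ' ω = CurveClass.mk c ∧
          IsCompactifiedImage ψ.boundaryExtension (sleTrace κ ω) (D'.pt 1) c := by
    obtain ⟨Γ', hΓ'm, hΓ'⟩ := exists_isSLECurve_through_of_ae_tendsto hgen htr hext (hmeas hgen) hψ
    obtain ⟨Γ₀, hΓ₀, rfl⟩ := hμ'
    exact ⟨Γ', IsSLECurve.map_eq_holds hΓ₀ (IsSLECurve.of_through hψ hΓ'm hΓ'), hΓ'm, hΓ'⟩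
  refine ⟨φ.pullbackHull D', Φ, hA, pullbackHull_carved_nonempty φ hr hrρ hwin hD', hΦ,
    fun B hB ↦ ?_⟩
  -- the test set `T_B = {c | c ∩ ψ̄(B) = ∅}`
  have hBsub : B ⊆ closure upperHalfPlaneSet := hB.isBoundedHull.subset_closure
  have h0B : (0 : ℂ) ∉ B := hB.zero_notMem
  have hBc : IsCompact B := hB.isBoundedHull.isCompact
  set T : Set (CurveClass ℂ) := CurveClass.rangeSubset (ψ.boundaryExtension '' B)ᶜ with hTdef
  have hTm : MeasurableSet T := CurveClass.measurableSet_rangeSubset_compl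
    (MarkedDomain.isCompact_image_boundaryExtension hC hBsub hBc).isClosed
  -- `μ'(T_B) = P[γ ∩ B = ∅]`
  have hL : preWienerMeasure.map Γ' T =
      preWienerMeasure {ω | Disjoint (range (sleTrace κ ω)) B} := by
    rw [Measure.map_apply_of_aemeasurable hΓ'm hTm]
    refine measure_congr (eventuallyEq_set.2 ?_)
    filter_upwards [hΓ'ae, h₆ hκ0 hκ4] with ω ⟨_, c', hΓ'ω, hc'⟩ hsimple
    rw [mem_preimage, hΓ'ω]
    exact hc'.mk_mem_rangeSubset_compl_image_iff hψ (sleTrace_zero _ ω) hsimple.2 hC hBsub h0B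
  -- `P({γ ∩ A = ∅} ∩ Γ⁻¹ T_B) = P[γ ∩ A = ∅, Φ(γ(0, ∞)) ∩ B = ∅]`
  have hR : preWienerMeasure
      ({ω | Disjoint (range (sleTrace κ ω)) (φ.pullbackHull D')} ∩ Γ ⁻¹' T) =
      preWienerMeasure {ω | Disjoint (range (sleTrace κ ω)) (φ.pullbackHull D') ∧
        ∀ t, 0 < t → Φ (sleTrace κ ω t) ∉ B} := by
    refine measure_congr (eventuallyEq_set.2 ?_)
    filter_upwards [hdesc, h₆ hκ0 hκ4] with ω ⟨c, hΓω, hc⟩ hsimple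
    constructor
    · rintro ⟨hE, hT⟩
      refine ⟨hE, ?_⟩
      rw [mem_preimage, hΓω] at hT
      exact (mk_mem_rangeSubset_compl_image_iff_of_disjoint hC hφ hsub hψ hψsymm
        (sleTrace_zero _ ω) hsimple.2 hc hE hBsub h0B).1 hT
    · rintro ⟨hE, hav⟩
      refine ⟨hE, ?_⟩
      rw [mem_preimage, hΓω]
      exact (mk_mem_rangeSubset_compl_image_iff_of_disjoint hC hφ hsub hψ hψsymm
        (sleTrace_zero _ ω) hsimple.2 hc hE hBsub h0B).2 hav
  rw [← hR, ← hcanT T hTm, hL, mul_comm]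

end Summit.CriticalPhenomena.SAWScalingLimit.Theorems.SubseqIdentification.BoundaryAreaLaw

end
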